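import Summits.ResolutionOfSingularities.ResolutionOfSingularities.Theorems.EquisingularLiftEquisingularLiftNatDirectionCentreSection
import Summits.ResolutionOfSingularities.ResolutionOfSingularities.Theorems.EquisingularLiftEquisingularLiftNatBlowupChartPointInjective
import Summits.ResolutionOfSingularities.ResolutionOfSingularities.Theorems.EquisingularLiftEquisingularLiftNatConeDeltaRegularCarrier
import Literature.AlgebraicGeometry.Resolution.BlowupAlgebraQuasiRegularChart
import Literature.AlgebraicGeometry.Resolution.EffectiveCartierStalks
import Literature.AlgebraicGeometry.Resolution.AlterationsSectionDivisor
import HarnessLib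

/-!
# [OURS · L1 W4.5(b) · EL♮(3)] T-DIRLIFT part D5 — THE LIFTED SECTION IS CARTIER ON THE EXCEPTIONAL DIVISOR:
# `IsEffectiveCartier ((controlledTransform τ I 𝒟 1).comap (I·𝒪_{X₁}).subschemeι)` (input `hC` of S6 (d) …NatTransportedCentre, and
# `hK𝓔` of res-D-pv-051's `exists_iso_subscheme_strictTransformIdeal_exceptional` p545368 for the OLD surface of a Čech round)

Crux chain w45b (cell `res-hironaka`, slot W4.5(b)), working crux **EL♮** = stmt-ResolutionOfSingularities-20038, child **EL♮(3)** =
stmt-ResolutionOfSingularities-20148, route EquisingularLift, line `sections`; rungs TOWER₃ / DIR₀₁ (Čech round). Written by res-L1-w45b-stub-2 g7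
(STATUS 2026-08-27T20:40Z «NEXT: T-DIRLIFT D5»). HONEST FRAMING: OURS; NOT a statement of any
manuscript; AI-written, weaker than expert review. No `sorry`; standard axioms; DEF-FREE. `--supports stmt-ResolutionOfSingularities-20148 --as helper`.

WHAT. For the blowing up `τ : X₁ ⟶ X` along `I` and a direction `𝒟` (`I·I ≤ 𝒟`, quasi-regular frames `(ℓ, m)` with `𝒟 = (ℓ) + (m²)` on `supp I`),
the direction centre `Γ̃ = controlledTransform τ I 𝒟 1` cuts an EFFECTIVE CARTIER divisor on the exceptional divisor `E = V(I·𝒪_{X₁})`: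
at a point `y` of `Γ̃` (necessarily on the chart `m`, T-DIRLIFT D1 p547943: `E_y = (τ♯m)`, `Γ̃_y = (τ♯m) + (χ(ℓ/m))`), the class of `χ(ℓ/m)` is a
nonzerodivisor of `𝒪_{E,y} = 𝒪_{X₁,y}/(τ♯m)` — on the chart algebra `A[I/m]/(m) ≅ (A/I)[T]` it is the VARIABLE `T` (Literature
`blowupAlgebraQuotEquiv`, Stacks 0BIQ), and `𝒪_{X₁,y}/(τ♯m)` is a localisation of `A[I/m]/(m)` (res-L1-w45b-stub-2's
`isLocalization_atPrime_quotient_of_surjective`, p535712); Stacks 01WS (`isEffectiveCartier_of_forall_mem_nonZeroDivisors`) concludes.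
* `mul_mem_span_of_frac_mul_mem` — `ℓ/m` is a nonzerodivisor modulo `m` in `A[I/m]`;
* `mul_mem_span_algebraMap_of_isLocalization` — regularity modulo a principal ideal passes to localisations;
* **`isEffectiveCartier_directionCentre_comap_exceptional`** — the theorem.

References (index only): T-DIRLIFT D1 p547943 / D2 p549717 / D3b p555056, T-PTPRIME-DICT 3 p540294 (`exists_chartPresentation_of_eq`,
`mem_chartPrime_iff_apply_mem_maximalIdeal`); Literature `EffectiveCartierStalks`, `BlowupAlgebraQuasiRegularChart`.
[cite: StacksProject, Tags 0BIQ, 01WS] [cite: Matsumura1987, §16] (index only).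
-/

set_option linter.dupNamespace false -- mandated namespace `Summit.<Summit>.<Problem>` of this single-conjunct summit

noncomputable section

open CategoryTheory CategoryTheory.Limits AlgebraicGeometry TopologicalSpace Topology IsLocalRing
open Literature.AlgebraicGeometry.Resolution
open AlgebraicGeometry.Scheme.IdealSheafData

namespace Summit.ResolutionOfSingularities.ResolutionOfSingularities.Cruxes.EquisingularLiftNat.Sections

universe u

/-! ## Ring lemmas -/

/-- **`ℓ/m` is a nonzerodivisor modulo `m` in the chart algebra `A[I/m]`** (`I = (ℓ, m)` quasi-regular): on `A[I/m]/(m) ≅ (A/I)[T]` it is the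
variable `T`. [cite: StacksProject, Tag 0BIQ] -/
theorem mul_mem_span_of_frac_mul_mem {A : Type u} [CommRing A] (c : Fin 2 → A) (hqr : IsQuasiRegular c)
    (b : blowupAlgebra (Ideal.span (Set.range c)) (c 1))
    (h : blowupAlgebra.frac c 1 0 * b ∈ Ideal.span {algebraMap A (blowupAlgebra (Ideal.span (Set.range c)) (c 1)) (c 1)}) :
    b ∈ Ideal.span {algebraMap A (blowupAlgebra (Ideal.span (Set.range c)) (c 1)) (c 1)} := by
  set e := blowupAlgebraQuotEquiv c 1 hqr with he
  have hX : e (MvPolynomial.X ⟨0, by decide⟩) = Ideal.Quotient.mk _ (blowupAlgebra.frac c 1 0) :=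
    blowupAlgebraQuotEquiv_X c 1 hqr ⟨0, by decide⟩
  rw [← Ideal.Quotient.eq_zero_iff_mem] at h ⊢
  rw [map_mul, ← hX] at h
  have h2 : MvPolynomial.X (R := A ⧸ Ideal.span (Set.range c)) (⟨0, by decide⟩ : {j : Fin 2 // j ≠ 1}) *
      e.symm (Ideal.Quotient.mk _ b) = 0 := by
    apply e.injective
    rw [map_mul, e.apply_symm_apply, map_zero, h]
  have h3 : e.symm (Ideal.Quotient.mk _ b) = 0 := by
    have hreg : IsLeftRegular (MvPolynomial.X (R := A ⧸ Ideal.span (Set.range c)) (⟨0, by decide⟩ : {j : Fin 2 // j ≠ 1})) :=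
      MvPolynomial.isRegular_X.left
    exact hreg (by beta_reduce; rw [h2, mul_zero])
  have h4 := congrArg e h3
  rwa [e.apply_symm_apply, map_zero] at h4

/-- **Regularity modulo a principal ideal passes to localisations**: if `a` is a nonzerodivisor modulo `(g)` in `B` and `S` is a localisation of
`B`, then `a` is a nonzerodivisor modulo `(g)S`. [folklore] -/
theorem mul_mem_span_algebraMap_of_isLocalization {B S : Type u} [CommRing B] [CommRing S] [Algebra B S] (M : Submonoid B)
    [IsLocalization M S] (a g : B) (hreg : ∀ b : B, a * b ∈ Ideal.span {g} → b ∈ Ideal.span {g}) (s : S)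
    (hs : algebraMap B S a * s ∈ Ideal.span {algebraMap B S g}) : s ∈ Ideal.span {algebraMap B S g} := by
  obtain ⟨⟨b, u⟩, hbu⟩ := IsLocalization.surj M s
  obtain ⟨t, ht⟩ := Ideal.mem_span_singleton'.mp hs
  obtain ⟨⟨b', u'⟩, hbu'⟩ := IsLocalization.surj M t
  simp only at hbu hbu'
  -- `a b u' = g b' u` in `S`, hence up to an element of `M` in `B`
  have h1 : algebraMap B S (a * b * u') = algebraMap B S (g * b' * u) := by
    simp only [map_mul]
    rw [← hbu, ← hbu']
    linear_combination (-(algebraMap B S (u : B) * algebraMap B S (u' : B))) * ht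
  obtain ⟨v, hv⟩ := (IsLocalization.eq_iff_exists M S).mp h1
  have h2 : a * (b * u' * v) ∈ Ideal.span {g} :=
    Ideal.mem_span_singleton'.mpr ⟨b' * u * v, by linear_combination -hv⟩
  obtain ⟨r, hr⟩ := Ideal.mem_span_singleton'.mp (hreg _ h2)
  -- `s = (b u' v) / (u u' v)`
  have hunit : IsUnit (algebraMap B S ((u * u' * v : M) : B)) := IsLocalization.map_units S (u * u' * v)
  have hs' : s * algebraMap B S ((u * u' * v : M) : B) = algebraMap B S (b * u' * v) := by
    simp only [Submonoid.coe_mul, map_mul]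
    rw [← hbu]
    ring
  have h4 : s * algebraMap B S ((u * u' * v : M) : B) ∈ Ideal.span {algebraMap B S g} := by
    rw [hs']
    exact Ideal.mem_span_singleton'.mpr ⟨algebraMap B S r, by rw [← map_mul, hr]⟩
  exact (Ideal.mul_unit_mem_iff_mem _ hunit).mp h4

/-! ## The theorem -/

section Cartier

variable {X₁ X : Scheme.{u}} {τ : X₁ ⟶ X} {I : X.IdealSheafData}

/-- **The lifted section is an effective Cartier divisor on the exceptional divisor** (see the module docstring).
[cite: StacksProject, Tags 0BIQ, 01WS] [OURS · L1 W4.5b · T-DIRLIFT D5] toward `stub_elnat_coneTowerPointResolution` /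
`stub_elnat_ratDirZeroPointResolution` (stmt-ResolutionOfSingularities-20148); NOT a statement of the manuscript. -/
theorem isEffectiveCartier_directionCentre_comap_exceptional [IsLocallyNoetherian X₁]
    (hτ : IsBlowup τ I) (𝒟 : X.IdealSheafData)
    (hdir : ∀ x ∈ I.support, ∃ c : Fin 2 → X.presheaf.stalk x, Ideal.span (Set.range c) = stalkIdeal I x ∧
      IsQuasiRegular c ∧ stalkIdeal 𝒟 x = Ideal.span {c 0} ⊔ Ideal.span {c 1 * c 1}) :
    IsEffectiveCartier ((controlledTransform τ I 𝒟 1).comap (I.comap τ).subschemeι) := by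
  classical
  haveI : IsLocallyNoetherian (I.comap τ).subscheme := LocallyOfFiniteType.isLocallyNoetherian (I.comap τ).subschemeι
  refine isEffectiveCartier_of_forall_mem_nonZeroDivisors fun w hw => ?_
  -- the point `y = ι w` of `Γ̃` and its image `x = τ y ∈ supp I`
  set ι := (I.comap τ).subschemeι with hιdef
  have hyΓ : ι w ∈ (controlledTransform τ I 𝒟 1).support := by
    have h : w ∈ ((((controlledTransform τ I 𝒟 1).comap ι).support : Set _)) := hw
    rw [Scheme.IdealSheafData.support_comap, Closeds.coe_preimage, Set.mem_preimage] at h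
    exact h
  have hyE : ι w ∈ ((I.comap τ).support : Set X₁) := by
    rw [← Scheme.IdealSheafData.range_subschemeι]; exact ⟨w, rfl⟩
  have hx : τ (ι w) ∈ I.support := by
    rw [Scheme.IdealSheafData.support_comap, Closeds.coe_preimage, Set.mem_preimage] at hyE
    exact hyE
  obtain ⟨c, hc, hqr, h𝒟⟩ := hdir _ hx
  obtain ⟨j, 𝔔, χ, hχ, hloc, -⟩ := exists_chartPresentation_of_eq hτ (ι w) rfl c hc
  -- the point of `Γ̃` lies on the chart `m` (`j = 1`): on the chart `ℓ` the centre is empty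
  have hj : j = 1 := by
    rcases Fin.exists_fin_two.mp ⟨j, rfl⟩ with hj | hj
    · exfalso
      subst hj
      have htop := stalkIdeal_directionCentre_of_chart_zero hτ 𝒟 (ι w) rfl c hc h𝒟 χ hχ
      exact ((mem_support_iff_stalkIdeal_le _ _).mp hyΓ |>.trans_lt
        (lt_top_iff_ne_top.mpr (maximalIdeal.isMaximal _).ne_top)).ne htop
    · exact hj
  subst hj
  obtain ⟨hE, hΓ⟩ := stalkIdeal_directionCentre_of_chart_one hτ 𝒟 (ι w) rfl c hc h𝒟 χ hχ
  set g := ((X.presheaf.stalkCongr (.of_eq rfl)).inv ≫ τ.stalkMap (ι w)).hom (c 1) with hgdef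
  set h := χ (blowupAlgebra.frac c 1 0) with hhdef
  -- KEY: `h` is a nonzerodivisor modulo `g` in `𝒪_{X₁,y}`
  letI := χ.toAlgebra
  haveI : IsLocalization.AtPrime (X₁.presheaf.stalk (ι w)) 𝔔.asIdeal := hloc
  have hg' : algebraMap _ (X₁.presheaf.stalk (ι w)) (algebraMap _ (blowupAlgebra (Ideal.span (Set.range c)) (c 1)) (c 1)) = g := hχ (c 1)
  have hkey : ∀ s : X₁.presheaf.stalk (ι w), h * s ∈ Ideal.span {g} → s ∈ Ideal.span {g} := by
    intro s hs
    rw [← hg'] at hs ⊢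
    exact mul_mem_span_algebraMap_of_isLocalization 𝔔.asIdeal.primeCompl _ _ (mul_mem_span_of_frac_mul_mem c hqr) s hs
  -- the stalk of `Γ̃|_E` at `w` is generated by the class of `h`, a nonzerodivisor of `𝒪_{E,w} = 𝒪_{X₁,y}/(g)`
  set ψ := (ι.stalkMap w).hom with hψ
  have hψsurj : Function.Surjective ψ := ι.stalkMap_surjective w
  have hψker : RingHom.ker ψ = Ideal.span {g} := by
    rw [hψ, ← stalkIdeal_ker_eq_ker_stalkMap, Scheme.IdealSheafData.ker_subschemeι, hE]
  refine ⟨ψ h, ?_, ?_⟩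
  · refine mem_nonZeroDivisors_iff_right.mpr fun t ht => ?_
    obtain ⟨s, rfl⟩ := hψsurj t
    rw [← map_mul, ← RingHom.mem_ker, hψker, mul_comm] at ht
    have hs := hkey s ht
    rw [← hψker, RingHom.mem_ker] at hs
    exact hs
  · rw [hψ, stalkIdeal_comap_eq_map_stalkMap, hΓ, Ideal.map_sup, Ideal.map_span, Ideal.map_span, Set.image_singleton,
      Set.image_singleton]
    have h0 : (ι.stalkMap w).hom g = 0 := by
      rw [← RingHom.mem_ker, ← hψ, hψker]; exact Ideal.mem_span_singleton_self g
    rw [h0, Ideal.span_singleton_zero, bot_sup_eq]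

end Cartier

end Summit.ResolutionOfSingularities.ResolutionOfSingularities.Cruxes.EquisingularLiftNat.Sections

end
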